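import Literature.AnabelianGeometry.EtaleTheta.Discharge.Sec2Cor219iSubquotientsInducedIff
import Literature.AnabelianGeometry.EtaleTheta.Discharge.Sec2Cor219iCoefficientAction

/-!
# [EtTh] Cor 2.19 (i), the two splittings (`RigidData.Cor219_i_splittings`, FACT-LIST F-0626):
# under Cor 2.18 (iii), CYCLOTOMIC RIGIDITY IS `thetaMod`-EQUIVARIANCE OF THE INDUCED ACTION —
# proof-only companion of `ThetaRigidity.lean`

Mochizuki, *The Étale Theta Function and its Frobenioid-theoretic Manifestations* [EtTh],
Publ. RIMS 45 (2009), §2, Cor 2.19 (i) p.64 (proof p.66 l.11–14: "the splitting … may be obtained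
directly from the theta section portion of the data [Def 2.13 (ii)(c)] … the splitting
corresponding to the algebraic section may then be constructed via … Proposition 2.14, (i)"),
Def 2.13 (ii) p.47 (PDF pages of the PRIMS text; bib key `MochizukiEtTh2009`). PROOF-ONLY (no
`def`, no new named fact, no instance; nothing of `ThetaRigidity.lean`, seat abc-iut-L2-t2, is
edited or restated); cell `abc-iut`, seat abc-iut-f-148 (complementary work on row F-0626 of
F-TRANCHES 147, first refusal offered to abc-iut-f-147; the universal closure of the row is refuted
at a toy by abc-iut-w5-d175, `ThetaRigiditySchemaWitness.lean`; the instance form of record is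
abc-iut-L2-d1's `cor219_i_splittings_of` ⟸ F-0620 ∧ F-0622 ∧ F-0623 ∧ F-0631 `Prop214_i`).

WHAT IS PROVED (for EVERY `R : RigidData N l`; `ᾱ` = the automorphism of `Π^tp_Y` INDUCED by an
automorphism `α` of the model `M(η)`, `RigidData.Induces`; `ι = inMu`, `π = proj`):

* `map_thetaImage_eq_of_induces` — the THETA-splitting clause of the row is FREE: for any
  `H ⊆ Π^tp_Ÿ ∩ Δ` with `ᾱ(H) = H`, `α(s^Θ(H)) = s^Θ(H)` (Def 2.13 (ii)(c): `α(Im s^Θ)` is a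
  `μ_N`-conjugate of `Im s^Θ`, and `μ_N`-conjugation is trivial over `Δ`); conversely
  `α(s^Θ(H)) = s^Θ(H)` forces `ᾱ(H) = H` (`Induces.map_comap_eq_of_map_thetaImage`);
* pointwise forms `Induces.apply_sTheta_eq` (`α(s^Θ(g)) = s^Θ(ᾱ g)`), `Induces.apply_sAlg_eq`
  (`α(s^alg(g)) = s^alg(ᾱ g)`) — the `Π^tp_Y`-level versions of abc-iut-w5-d145's `iso_sTheta_eq`
  / `iso_sAlg_eq` (which lie over an automorphism `γ` of `Π^tp_X`);
* NECESSITY `Induces.inMu_thetaMod_eq_of_clauses`: the two clauses give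
  `α(ι(thetaMod g)) = ι(thetaMod(ᾱ g))` on `l·Δ_Θ` — `α` acts on the exterior cyclotome `μ_N`
  THROUGH `thetaMod` by its induced action on `l·Δ_Θ` (w5-d145's `iso_inMu_thetaMod`, re-threaded);
* SUFFICIENCY `apply_sAlg_eq_of_equivariance`, `map_algImage_lDeltaTheta_eq_of_equivariance`: that
  `thetaMod`-EQUIVARIANCE (plus `ᾱ(l·Δ_Θ) = l·Δ_Θ`) gives back the ALGEBRAIC-splitting clause,
  since `s^alg = ι(thetaMod) · s^Θ` on `l·Δ_Θ` (`sAlg_mul_sTheta_inv`, the cyclotomic rigidity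
  isomorphism of the model);
* **`cor219_i_splittings_iff_induced_equivariance`** — under F-0623 `Cor218_iii_quotient` (every
  automorphism induces one), `Cor219_i_splittings` ⟺ for every automorphism `α` of every model
  `M(η)`, the induced `ᾱ` preserves `l·Δ_Θ` and `α|μ_N ∘ thetaMod = thetaMod ∘ ᾱ` on `l·Δ_Θ`;
  `cor219_i_splittings_of_induced_equivariance` is the hypothesis-free ⟸. So F-0626 = «a model
  automorphism acts on `μ_N` by the coefficient automorphism of its induced action on `l·Δ_Θ`»,
  nothing more or less; the route of record supplies the RHS from Prop 2.14 (i).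

HONEST FRAMING: a characterisation of a typed interface row, kernel-checked; nothing here asserts
a disputed claim or takes a side on [IUTchIII] Cor 3.12. [EtTh] is refereed; typed ≠ proved.
-/

namespace Literature.AnabelianGeometry.EtaleTheta

universe u

namespace RigidData

variable {N : ℕ+} {l : ℕ} (R : RigidData.{u} N l)

/-! ## Bookkeeping -/

/-- `proj(s^Θ(H ∩ Π^tp_Ÿ)) = H ∩ Π^tp_Y` for `H ⊆ Π^tp_Ÿ`.
[cite: MochizukiEtTh2009, Cor 2.19(i) p.64] -/
theorem map_proj_thetaImage {η : R.PiYdd → R.mu} (hη : η ∈ R.thetaCocycles) (H : Subgroup R.PiX)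
    (hH : H ≤ R.PiYdd) :
    (R.thetaImage hη H).map (CycEnvelope.proj R.augY R.chi) = H.comap R.PiY.subtype := by
  ext p
  simp only [thetaImage, Subgroup.map_map, Subgroup.mem_map, Subgroup.mem_subgroupOf,
    Subgroup.mem_comap, Subgroup.coe_subtype, MonoidHom.coe_comp, Function.comp_apply]
  constructor
  · rintro ⟨q, hq, rfl⟩
    exact hq
  · intro hp
    exact ⟨⟨p, hH hp⟩, hp, rfl⟩

variable {R}

/-- If `ᾱ(H ∩ Π^tp_Y) = H ∩ Π^tp_Y`, then `ᾱ g ∈ H` for `g ∈ H ∩ Π^tp_Ÿ`.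
[cite: MochizukiEtTh2009, Cor 2.18(i) p.60] -/
theorem mem_apply_of_map_comap_eq {a : R.PiY ≃ₜ* R.PiY} {H : Subgroup R.PiX}
    (hHa : (H.comap R.PiY.subtype).map a.toMulEquiv.toMonoidHom = H.comap R.PiY.subtype)
    (g : R.PiYdd) (hg : (g : R.PiX) ∈ H) : ((a (R.inclYdd g) : R.PiY) : R.PiX) ∈ H := by
  have h : a (R.inclYdd g) ∈ H.comap R.PiY.subtype := by
    rw [← hHa]
    exact ⟨R.inclYdd g, hg, rfl⟩
  exact h

/-! ## The theta splitting: invariance is free (Def 2.13 (ii)(c)) -/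

/-- **Pointwise theta transport**: if `α` induces `a` and preserves `s^Θ(H)`, then
`α(s^Θ(g)) = s^Θ(ᾱ g)` for `g ∈ H ∩ Π^tp_Ÿ` (and `ᾱ g ∈ H ∩ Π^tp_Ÿ`).
[cite: MochizukiEtTh2009, Cor 2.19(i) p.66] -/
theorem Induces.apply_sTheta_eq {η : R.PiYdd → R.mu} {hη : η ∈ R.thetaCocycles} {α : MulAut R.env}
    {a : R.PiY ≃ₜ* R.PiY} (hα : R.Induces α a) {H : Subgroup R.PiX}
    (hth : (R.thetaImage hη H).map α.toMonoidHom = R.thetaImage hη H) (g : R.PiYdd)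
    (hg : (g : R.PiX) ∈ H) :
    ∃ h₂ : ((a (R.inclYdd g) : R.PiY) : R.PiX) ∈ R.PiYdd,
      ((a (R.inclYdd g) : R.PiY) : R.PiX) ∈ H ∧
        α (R.toThetaEnvData.sTheta hη g) =
          R.toThetaEnvData.sTheta hη ⟨((a (R.inclYdd g) : R.PiY) : R.PiX), h₂⟩ := by
  have hmem : α (R.toThetaEnvData.sTheta hη g) ∈ R.thetaImage hη H := by
    rw [← hth]
    exact ⟨_, (R.mem_thetaImage_iff hη _ _).2 ⟨g, hg, rfl⟩, rfl⟩
  obtain ⟨g₂, hg₂, hg₂eq⟩ := (R.mem_thetaImage_iff hη _ _).1 hmem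
  have hproj : R.inclYdd g₂ = a (R.inclYdd g) := by
    have h := hα (R.toThetaEnvData.sTheta hη g)
    rw [← hg₂eq] at h
    exact h
  have hcoe : ((a (R.inclYdd g) : R.PiY) : R.PiX) = (g₂ : R.PiX) :=
    (congrArg (fun q : R.PiY => (q : R.PiX)) hproj).symm
  refine ⟨hcoe ▸ g₂.2, hcoe ▸ hg₂, ?_⟩
  rw [← hg₂eq]
  congr 1
  exact Subtype.ext hcoe.symm

/-- **Pointwise algebraic transport**: if `α` induces `a` and preserves `s^alg(H)`, then
`α(s^alg(g)) = s^alg(ᾱ g)` for `g ∈ H ∩ Π^tp_Ÿ`. [cite: MochizukiEtTh2009, Cor 2.19(i) p.66] -/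
theorem Induces.apply_sAlg_eq {α : MulAut R.env} {a : R.PiY ≃ₜ* R.PiY} (hα : R.Induces α a)
    {H : Subgroup R.PiX} (halg : (R.algImage H).map α.toMonoidHom = R.algImage H) (g : R.PiYdd)
    (hg : (g : R.PiX) ∈ H) :
    ∃ h₂ : ((a (R.inclYdd g) : R.PiY) : R.PiX) ∈ R.PiYdd,
      ((a (R.inclYdd g) : R.PiY) : R.PiX) ∈ H ∧
        α (R.toThetaEnvData.sAlg g) =
          R.toThetaEnvData.sAlg ⟨((a (R.inclYdd g) : R.PiY) : R.PiX), h₂⟩ := by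
  have hmem : α (R.toThetaEnvData.sAlg g) ∈ R.algImage H := by
    rw [← halg]
    exact ⟨_, (R.mem_algImage_iff _ _).2 ⟨g, hg, rfl⟩, rfl⟩
  obtain ⟨g₂, hg₂, hg₂eq⟩ := (R.mem_algImage_iff _ _).1 hmem
  have hproj : R.inclYdd g₂ = a (R.inclYdd g) := by
    have h := hα (R.toThetaEnvData.sAlg g)
    rw [← hg₂eq] at h
    exact h
  have hcoe : ((a (R.inclYdd g) : R.PiY) : R.PiX) = (g₂ : R.PiX) :=
    (congrArg (fun q : R.PiY => (q : R.PiX)) hproj).symm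
  refine ⟨hcoe ▸ g₂.2, hcoe ▸ hg₂, ?_⟩
  rw [← hg₂eq]
  congr 1
  exact Subtype.ext hcoe.symm

/-- **Necessity for the theta clause**: `α(s^Θ(H)) = s^Θ(H)` forces `ᾱ(H ∩ Π^tp_Y) = H ∩ Π^tp_Y`
(apply `proj`). [cite: MochizukiEtTh2009, Cor 2.19(i) p.66] -/
theorem Induces.map_comap_eq_of_map_thetaImage {η : R.PiYdd → R.mu} {hη : η ∈ R.thetaCocycles}
    {α : MulAut R.env} {a : R.PiY ≃ₜ* R.PiY} (hα : R.Induces α a) {H : Subgroup R.PiX}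
    (hH : H ≤ R.PiYdd) (hth : (R.thetaImage hη H).map α.toMonoidHom = R.thetaImage hη H) :
    (H.comap R.PiY.subtype).map a.toMulEquiv.toMonoidHom = H.comap R.PiY.subtype := by
  rw [← R.map_proj_thetaImage hη H hH, ← hα.map_proj_map, hth]

/-- **The theta splitting is preserved for free**: for an automorphism `α` of a model `M(η)`
inducing `ᾱ` with `ᾱ(H) = H`, `H ⊆ Π^tp_Ÿ ∩ Δ`, one has `α(s^Θ_η(H)) = s^Θ_η(H)` — since
`s^Θ_η(H) = Im(s^Θ_η) ∩ π⁻¹(H)`, `α(Im s^Θ_η)` is a `μ_N`-conjugate of `Im s^Θ_η` (Def 2.13 (ii)(c))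
and `μ_N`-conjugation is trivial over `Δ`. No Prop 2.14 (i), no temp-slimness.
[cite: MochizukiEtTh2009, Cor 2.19(i) p.66] -/
theorem map_thetaImage_eq_of_induces {η : R.PiYdd → R.mu} {hη : η ∈ R.thetaCocycles}
    (α : (R.modelMono hη).Iso (R.modelMono hη)) {a : R.PiY ≃ₜ* R.PiY}
    (hα : R.Induces α.e.toMulEquiv a) (H : Subgroup R.PiX) (hH : H ≤ R.PiYdd ⊓ R.aug.ker)
    (hHa : (H.comap R.PiY.subtype).map a.toMulEquiv.toMonoidHom = H.comap R.PiY.subtype) :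
    (R.thetaImage hη H).map α.e.toMulEquiv.toMonoidHom = R.thetaImage hη H := by
  obtain ⟨c, hc⟩ := R.toThetaEnvData.exists_map_range_sTheta_eq α
  have hle : (H.comap R.PiY.subtype).comap (CycEnvelope.proj R.augY R.chi) ≤
      CycEnvelope.deltaEnv R.augY R.chi := fun x hx => by
    rw [CycEnvelope.mem_deltaEnv_iff, MonoidHom.mem_ker]
    exact (hH.trans inf_le_right) hx
  have hC : ((H.comap R.PiY.subtype).comap (CycEnvelope.proj R.augY R.chi)).map
      α.e.toMulEquiv.toMonoidHom = (H.comap R.PiY.subtype).comap (CycEnvelope.proj R.augY R.chi) :=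
    (hα.map_comap_proj_eq_iff _).mpr hHa
  have hC' : ((H.comap R.PiY.subtype).comap (CycEnvelope.proj R.augY R.chi)).map
      (MulAut.conj (CycEnvelope.inMu R.augY R.chi c)).toMonoidHom =
        (H.comap R.PiY.subtype).comap (CycEnvelope.proj R.augY R.chi) :=
    R.toThetaEnvData.map_conj_inMu_eq_of_le hle c
  rw [R.thetaImage_eq_range_inf hη H, Subgroup.map_inf_eq _ _ _ α.e.injective, hc, hC]
  conv_lhs => rw [← hC', ← Subgroup.map_inf_eq _ _ _ (MulAut.conj _).injective]
  rw [← R.thetaImage_eq_range_inf hη H]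
  exact R.toThetaEnvData.map_conj_inMu_eq_of_le
    (R.thetaImage_le_deltaEnv hη (hH.trans inf_le_right)) c

/-- In particular the THETA clause of `Cor219_i_splittings` ⟺ `ᾱ(l·Δ_Θ) = l·Δ_Θ`, for every
automorphism of a model inducing `ᾱ`. [cite: MochizukiEtTh2009, Cor 2.19(i) p.66] -/
theorem map_thetaImage_lDeltaTheta_eq_iff {η : R.PiYdd → R.mu} {hη : η ∈ R.thetaCocycles}
    (α : (R.modelMono hη).Iso (R.modelMono hη)) {a : R.PiY ≃ₜ* R.PiY}
    (hα : R.Induces α.e.toMulEquiv a) :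
    (R.thetaImage hη R.lDeltaTheta).map α.e.toMulEquiv.toMonoidHom = R.thetaImage hη R.lDeltaTheta ↔
      (R.lDeltaTheta.comap R.PiY.subtype).map a.toMulEquiv.toMonoidHom =
        R.lDeltaTheta.comap R.PiY.subtype :=
  ⟨hα.map_comap_eq_of_map_thetaImage (R.lDeltaTheta_le.trans inf_le_left),
    map_thetaImage_eq_of_induces α hα R.lDeltaTheta R.lDeltaTheta_le⟩

/-! ## The algebraic splitting: `thetaMod`-equivariance on the exterior cyclotome -/

/-- `s^alg(g) = ι(thetaMod g) · s^Θ(g)` on `l·Δ_Θ` (the model's cyclotomic rigidity isomorphism,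
`sAlg_mul_sTheta_inv`, solved for `s^alg`). [cite: MochizukiEtTh2009, Cor 2.19(i) p.64] -/
theorem sAlg_eq_inMu_thetaMod_mul_sTheta {η : R.PiYdd → R.mu} (hη : η ∈ R.thetaCocycles)
    (g : R.PiYdd) (hg : (g : R.PiX) ∈ R.lDeltaTheta) :
    R.toThetaEnvData.sAlg g = CycEnvelope.inMu R.augY R.chi (R.thetaMod ⟨(g : R.PiX), hg⟩) *
      R.toThetaEnvData.sTheta hη g := by
  rw [← R.sAlg_mul_sTheta_inv hη g hg, inv_mul_cancel_right]

/-- **Necessity: the two clauses give `thetaMod`-equivariance.** If `α` induces `ᾱ` and preserves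
both `s^alg(l·Δ_Θ)` and `s^Θ(l·Δ_Θ)`, then `α(ι(thetaMod g)) = ι(thetaMod(ᾱ g))` for `g ∈ l·Δ_Θ`:
`α` acts on the exterior cyclotome through `thetaMod` by its induced action (abc-iut-w5-d145's
`iso_inMu_thetaMod`, at the `Π^tp_Y`-level). [cite: MochizukiEtTh2009, Cor 2.19(i) p.64] -/
theorem Induces.inMu_thetaMod_eq_of_clauses {η : R.PiYdd → R.mu} {hη : η ∈ R.thetaCocycles}
    {α : MulAut R.env} {a : R.PiY ≃ₜ* R.PiY} (hα : R.Induces α a)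
    (halg : (R.algImage R.lDeltaTheta).map α.toMonoidHom = R.algImage R.lDeltaTheta)
    (hth : (R.thetaImage hη R.lDeltaTheta).map α.toMonoidHom = R.thetaImage hη R.lDeltaTheta)
    (g : R.PiYdd) (hg : (g : R.PiX) ∈ R.lDeltaTheta) :
    ∃ hg' : ((a (R.inclYdd g) : R.PiY) : R.PiX) ∈ R.lDeltaTheta,
      α (CycEnvelope.inMu R.augY R.chi (R.thetaMod ⟨(g : R.PiX), hg⟩)) =
        CycEnvelope.inMu R.augY R.chi (R.thetaMod ⟨((a (R.inclYdd g) : R.PiY) : R.PiX), hg'⟩) := by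
  obtain ⟨h₂, hg₂, hsAlg⟩ := hα.apply_sAlg_eq halg g hg
  obtain ⟨_, -, hsTheta⟩ := hα.apply_sTheta_eq hth g hg
  refine ⟨hg₂, ?_⟩
  rw [← R.sAlg_mul_sTheta_inv hη g hg, map_mul, map_inv, hsAlg, hsTheta]
  exact R.sAlg_mul_sTheta_inv hη ⟨_, h₂⟩ hg₂

/-- **Sufficiency, pointwise: `thetaMod`-equivariance ⇒ `α(s^alg(g)) = s^alg(ᾱ g)` on `l·Δ_Θ`.**
For an automorphism `α` of a model `M(η)` inducing `ᾱ` with `ᾱ(l·Δ_Θ) = l·Δ_Θ` and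
`α(ι(thetaMod g)) = ι(thetaMod(ᾱ g))`: `α(s^alg g) = α(ι(thetaMod g))·α(s^Θ g) =
ι(thetaMod(ᾱ g))·s^Θ(ᾱ g) = s^alg(ᾱ g)`. [cite: MochizukiEtTh2009, Cor 2.19(i) p.66] -/
theorem apply_sAlg_eq_of_equivariance {η : R.PiYdd → R.mu} {hη : η ∈ R.thetaCocycles}
    (α : (R.modelMono hη).Iso (R.modelMono hη)) {a : R.PiY ≃ₜ* R.PiY}
    (hα : R.Induces α.e.toMulEquiv a)
    (hL : (R.lDeltaTheta.comap R.PiY.subtype).map a.toMulEquiv.toMonoidHom =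
      R.lDeltaTheta.comap R.PiY.subtype)
    (hμ : ∀ (g : R.PiYdd) (hg : (g : R.PiX) ∈ R.lDeltaTheta),
      ∃ hg' : ((a (R.inclYdd g) : R.PiY) : R.PiX) ∈ R.lDeltaTheta,
        α.e.toMulEquiv (CycEnvelope.inMu R.augY R.chi (R.thetaMod ⟨(g : R.PiX), hg⟩)) =
          CycEnvelope.inMu R.augY R.chi (R.thetaMod ⟨((a (R.inclYdd g) : R.PiY) : R.PiX), hg'⟩))
    (g : R.PiYdd) (hg : (g : R.PiX) ∈ R.lDeltaTheta) :
    ∃ h₂ : ((a (R.inclYdd g) : R.PiY) : R.PiX) ∈ R.PiYdd,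
      α.e.toMulEquiv (R.toThetaEnvData.sAlg g) =
        R.toThetaEnvData.sAlg ⟨((a (R.inclYdd g) : R.PiY) : R.PiX), h₂⟩ := by
  have hth := map_thetaImage_eq_of_induces α hα R.lDeltaTheta R.lDeltaTheta_le hL
  obtain ⟨h₂, hg₂, hsTheta⟩ := hα.apply_sTheta_eq hth g hg
  obtain ⟨hg', hμg⟩ := hμ g hg
  refine ⟨h₂, ?_⟩
  rw [R.sAlg_eq_inMu_thetaMod_mul_sTheta hη g hg, map_mul, hμg, hsTheta,
    R.sAlg_eq_inMu_thetaMod_mul_sTheta hη ⟨_, h₂⟩ hg']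

/-- **Sufficiency: `thetaMod`-equivariance ⇒ the ALGEBRAIC-splitting clause** `α(s^alg(l·Δ_Θ)) =
s^alg(l·Δ_Θ)`. [cite: MochizukiEtTh2009, Cor 2.19(i) p.66] -/
theorem map_algImage_lDeltaTheta_eq_of_equivariance {η : R.PiYdd → R.mu}
    {hη : η ∈ R.thetaCocycles} (α : (R.modelMono hη).Iso (R.modelMono hη)) {a : R.PiY ≃ₜ* R.PiY}
    (hα : R.Induces α.e.toMulEquiv a)
    (hL : (R.lDeltaTheta.comap R.PiY.subtype).map a.toMulEquiv.toMonoidHom =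
      R.lDeltaTheta.comap R.PiY.subtype)
    (hμ : ∀ (g : R.PiYdd) (hg : (g : R.PiX) ∈ R.lDeltaTheta),
      ∃ hg' : ((a (R.inclYdd g) : R.PiY) : R.PiX) ∈ R.lDeltaTheta,
        α.e.toMulEquiv (CycEnvelope.inMu R.augY R.chi (R.thetaMod ⟨(g : R.PiX), hg⟩)) =
          CycEnvelope.inMu R.augY R.chi (R.thetaMod ⟨((a (R.inclYdd g) : R.PiY) : R.PiX), hg'⟩)) :
    (R.algImage R.lDeltaTheta).map α.e.toMulEquiv.toMonoidHom = R.algImage R.lDeltaTheta := by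
  apply le_antisymm
  · rintro _ ⟨x, hx, rfl⟩
    obtain ⟨g, hg, rfl⟩ := (R.mem_algImage_iff _ _).1 hx
    obtain ⟨h₂, he⟩ := apply_sAlg_eq_of_equivariance α hα hL hμ g hg
    change α.e.toMulEquiv (R.toThetaEnvData.sAlg g) ∈ R.algImage R.lDeltaTheta
    rw [he]
    exact (R.mem_algImage_iff _ _).2 ⟨⟨_, h₂⟩, mem_apply_of_map_comap_eq hL g hg, rfl⟩
  · intro x hx
    obtain ⟨g, hg, rfl⟩ := (R.mem_algImage_iff _ _).1 hx
    have hgL : R.inclYdd g ∈ (R.lDeltaTheta.comap R.PiY.subtype).map a.toMulEquiv.toMonoidHom := by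
      rw [hL]
      exact hg
    obtain ⟨p, hp, hpa⟩ := hgL
    have hpYdd : (p : R.PiX) ∈ R.PiYdd := (R.lDeltaTheta_le hp).1
    obtain ⟨h₂, he⟩ := apply_sAlg_eq_of_equivariance α hα hL hμ ⟨(p : R.PiX), hpYdd⟩ hp
    refine ⟨R.toThetaEnvData.sAlg ⟨(p : R.PiX), hpYdd⟩,
      (R.mem_algImage_iff _ _).2 ⟨⟨(p : R.PiX), hpYdd⟩, hp, rfl⟩, ?_⟩
    change α.e.toMulEquiv (R.toThetaEnvData.sAlg ⟨(p : R.PiX), hpYdd⟩) = R.toThetaEnvData.sAlg g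
    rw [he]
    congr 1
    apply Subtype.ext
    have hincl : R.inclYdd ⟨(p : R.PiX), hpYdd⟩ = p := Subtype.ext rfl
    change ((a (R.inclYdd ⟨(p : R.PiX), hpYdd⟩) : R.PiY) : R.PiX) = (g : R.PiX)
    rw [hincl]
    exact congrArg (fun q : R.PiY => (q : R.PiX)) hpa

/-! ## The row, from and as `thetaMod`-equivariance of the induced action -/

variable (R)

/-- **`Cor219_i_splittings` from `thetaMod`-equivariance** (no other hypothesis): if every
automorphism `α` of every model `M(η)` induces an `ᾱ` with `ᾱ(l·Δ_Θ) = l·Δ_Θ` and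
`α(ι(thetaMod g)) = ι(thetaMod(ᾱ g))` on `l·Δ_Θ`, then both splittings are preserved (row F-0626).
[cite: MochizukiEtTh2009, Cor 2.19(i) p.64] -/
theorem cor219_i_splittings_of_induced_equivariance
    (hY : ∀ (η : R.PiYdd → R.mu) (hη : η ∈ R.thetaCocycles)
      (α : (R.modelMono hη).Iso (R.modelMono hη)),
      ∃ a : R.PiY ≃ₜ* R.PiY, R.Induces α.e.toMulEquiv a ∧
        (R.lDeltaTheta.comap R.PiY.subtype).map a.toMulEquiv.toMonoidHom =
          R.lDeltaTheta.comap R.PiY.subtype ∧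
        ∀ (g : R.PiYdd) (hg : (g : R.PiX) ∈ R.lDeltaTheta),
          ∃ hg' : ((a (R.inclYdd g) : R.PiY) : R.PiX) ∈ R.lDeltaTheta,
            α.e.toMulEquiv (CycEnvelope.inMu R.augY R.chi (R.thetaMod ⟨(g : R.PiX), hg⟩)) =
              CycEnvelope.inMu R.augY R.chi
                (R.thetaMod ⟨((a (R.inclYdd g) : R.PiY) : R.PiX), hg'⟩)) :
    R.Cor219_i_splittings := by
  intro η hη α
  obtain ⟨a, hα, hL, hμ⟩ := hY η hη α
  exact ⟨map_algImage_lDeltaTheta_eq_of_equivariance α hα hL hμ,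
    map_thetaImage_eq_of_induces α hα R.lDeltaTheta R.lDeltaTheta_le hL⟩

/-- **F-0626 characterised under F-0623: cyclotomic rigidity IS `thetaMod`-equivariance.** If
`Ker(Π• ↠ Π•_Y)` is the union of the centralisers of the open subgroups (`Cor218_iii_quotient`, so
that every automorphism of a model induces one of `Π^tp_Y`), then `Cor219_i_splittings` holds for
`R` IF AND ONLY IF for every automorphism `α` of every model `M(η)` the induced `ᾱ` preserves
`l·Δ_Θ` and `α` acts on the exterior cyclotome `μ_N` through `thetaMod` by `ᾱ`:
`α(ι(thetaMod g)) = ι(thetaMod(ᾱ g))` for all `g ∈ l·Δ_Θ`.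
[cite: MochizukiEtTh2009, Cor 2.19(i) p.64] -/
theorem cor219_i_splittings_iff_induced_equivariance (h : R.Cor218_iii_quotient) :
    R.Cor219_i_splittings ↔
      ∀ (η : R.PiYdd → R.mu) (hη : η ∈ R.thetaCocycles)
        (α : (R.modelMono hη).Iso (R.modelMono hη)),
        ∃ a : R.PiY ≃ₜ* R.PiY, R.Induces α.e.toMulEquiv a ∧
          (R.lDeltaTheta.comap R.PiY.subtype).map a.toMulEquiv.toMonoidHom =
            R.lDeltaTheta.comap R.PiY.subtype ∧
          ∀ (g : R.PiYdd) (hg : (g : R.PiX) ∈ R.lDeltaTheta),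
            ∃ hg' : ((a (R.inclYdd g) : R.PiY) : R.PiX) ∈ R.lDeltaTheta,
              α.e.toMulEquiv (CycEnvelope.inMu R.augY R.chi (R.thetaMod ⟨(g : R.PiX), hg⟩)) =
                CycEnvelope.inMu R.augY R.chi
                  (R.thetaMod ⟨((a (R.inclYdd g) : R.PiY) : R.PiX), hg'⟩) := by
  refine ⟨fun h219 η hη α => ?_, R.cor219_i_splittings_of_induced_equivariance⟩
  obtain ⟨a, hα⟩ := exists_induces_iso h α
  obtain ⟨halg, hth⟩ := h219 η hη α
  exact ⟨a, hα, hα.map_comap_eq_of_map_thetaImage (R.lDeltaTheta_le.trans inf_le_left) hth,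
    fun g hg => hα.inMu_thetaMod_eq_of_clauses halg hth g hg⟩

/-- Reading with ANY inducing `ᾱ` (`Induces.unique`): under `Cor219_i_splittings`, every inducing
pair `(α, a)` at a model has `a(l·Δ_Θ) = l·Δ_Θ` and acts `thetaMod`-equivariantly on `μ_N`.
[cite: MochizukiEtTh2009, Cor 2.19(i) p.64] -/
theorem induced_equivariance_of_cor219_i_splittings (h219 : R.Cor219_i_splittings)
    {η : R.PiYdd → R.mu} {hη : η ∈ R.thetaCocycles} (α : (R.modelMono hη).Iso (R.modelMono hη))
    {a : R.PiY ≃ₜ* R.PiY} (hα : R.Induces α.e.toMulEquiv a) :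
    (R.lDeltaTheta.comap R.PiY.subtype).map a.toMulEquiv.toMonoidHom =
        R.lDeltaTheta.comap R.PiY.subtype ∧
      ∀ (g : R.PiYdd) (hg : (g : R.PiX) ∈ R.lDeltaTheta),
        ∃ hg' : ((a (R.inclYdd g) : R.PiY) : R.PiX) ∈ R.lDeltaTheta,
          α.e.toMulEquiv (CycEnvelope.inMu R.augY R.chi (R.thetaMod ⟨(g : R.PiX), hg⟩)) =
            CycEnvelope.inMu R.augY R.chi (R.thetaMod ⟨((a (R.inclYdd g) : R.PiY) : R.PiX), hg'⟩) :=
  let ⟨halg, hth⟩ := h219 η hη α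
  ⟨hα.map_comap_eq_of_map_thetaImage (R.lDeltaTheta_le.trans inf_le_left) hth,
    fun g hg => hα.inMu_thetaMod_eq_of_clauses halg hth g hg⟩

end RigidData

end Literature.AnabelianGeometry.EtaleTheta
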